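import Summits.Ventures.QEC.Census.CertChunks
import Summits.Ventures.QEC.Census.LP.LP36w5.Cert
import HarnessLib

/-!
# `LP36w5` — KERNEL-tier lower-bound replay, side X, leaf file 1/1 (emitted by qec-search-7)

Bruteforce replay (CERT-FORMAT v1 §5.1, lemma L3) of the certificate `371103695c3e0abc`: every X-type operator of weight
`1 … 5` has nonzero syndrome (rows `cert.HZ`) or is allow-listed (allow-list [8654913, 35433545985, 553665537, 794754, 3221357058, 50366466, 100728900, 1589508, 6442456068, 201457800, 3179016, 12884912136, 25769820240, 402657552, 6358032, 51539640480, 805315104, 12716064]). This file holds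
3 packed chunk evaluations (`chunk1R`/`chunk2R` of `Census/CertChunks.lean` over `posList 36 cert.HZ`), total
443703 scan end points, each closed by `decide +kernel` — tier KERNEL (CERTIFIED): axioms ⊆ {propext, Classical.choice,
Quot.sound}. Assembled in `LP/LP36w5/KernelX.lean`. Do not edit; re-emit (HOME/census/search-7/emit_kernel.py).
-/

namespace Summit.Ventures.QEC.Census.LP36w5

/-- Level-1 chunks `i`, `0 ≤ i < 3`, side X of `LP36w5` (159430 end points): pass. -/
theorem kX1_0 : chunk1R (leafTest [8654913, 35433545985, 553665537, 794754, 3221357058, 50366466, 100728900, 1589508, 6442456068, 201457800, 3179016, 12884912136, 25769820240, 402657552, 6358032, 51539640480, 805315104, 12716064]) (posList 36 cert.HZ) 4 0 3 = true := by decide +kernel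

/-- Level-1 chunks `i`, `3 ≤ i < 9`, side X of `LP36w5` (182690 end points): pass. -/
theorem kX1_3 : chunk1R (leafTest [8654913, 35433545985, 553665537, 794754, 3221357058, 50366466, 100728900, 1589508, 6442456068, 201457800, 3179016, 12884912136, 25769820240, 402657552, 6358032, 51539640480, 805315104, 12716064]) (posList 36 cert.HZ) 4 3 6 = true := by decide +kernel

/-- Level-1 chunks `i`, `9 ≤ i < 36`, side X of `LP36w5` (101583 end points): pass. -/
theorem kX1_9 : chunk1R (leafTest [8654913, 35433545985, 553665537, 794754, 3221357058, 50366466, 100728900, 1589508, 6442456068, 201457800, 3179016, 12884912136, 25769820240, 402657552, 6358032, 51539640480, 805315104, 12716064]) (posList 36 cert.HZ) 4 9 27 = true := by decide +kernel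

end Summit.Ventures.QEC.Census.LP36w5
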